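import Literature.NumberTheory.GelbartRogawski1991.LocalDoubledSiegelUnipotentAnisotropy
import Literature.NumberTheory.Automorphic.Liu2021.AnisotropicPlaneNormFormOfHilbertSymbol
import HarnessLib

-- buildfix G11b-3 recipe (LEDGER B13-1/B13-3), as in the GelbartRogawski1991 siblings: elaborate sequentially.
set_option Elab.async false

/-!
# The Rao parameter of a skew-scalar Siegel unipotent of the doubled ANISOTROPIC PLANE `T₁ ⊕ αT₁` (`(−α⁻¹, δ²)_v = −1`) is anisotropic —
# the (AN) adapter of the soft road, CM tokens

Topic `NumberTheory/GelbartRogawski1991`; namespace `Literature.NumberTheory.GelbartRogawski1991.UnitaryDualPair.LocalSplitting` (sequel of ★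
`LocalDoubledSiegelUnipotentAnisotropy`).  KERNEL ONLY: theorems; no definition, no named fact, no instance, no notation, no `sorry`.

For a CM field `L` (`δ = imagUnit L`, `δ² = imagUnitSq L`), a finite place `v` of `L⁺`, the plane `T = T₁ ⊕ᶠ T₂`, `T₂ = α • T₁`, `det T₁` a unit,
`(−α⁻¹, δ²)_v = −1`, a MOVER `E″` of the doubled rank-two symplectic space (`E″ ℓ_Δ = ℓ_Y`) and a non-zero SKEW scalar `τ ∈ L ⊗ L⁺_v` (`c̄ τ = −τ`):
the second-degree function `halfForm (c ·)` of the Rao parameter `c = cOfFix 𝕋 (E″ · ι(n(τ·1)) · E″⁻¹)` of the Siegel unipotent `n(τ · 1_V)` of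
`U(V ⊕ −V)(L⁺_v)` (★ `nElem`, ★ `skew_smul_one`; the Kronecker image of the rank-one Siegel unipotent, ★ `kronLoc_nElem`) is ANISOTROPIC on `L⁺_v^{2+2}`:
`halfForm (c ·) x = 0 → x = 0`.  This is ★ LD2-p02 (g3) `halfForm_cOfFix_mover_conj_nElem_eq_zero_iff` (anisotropy TRANSFER from `h_{𝕋₀}`, any mover)
with its input `hS` («`T ⊗ 1` anisotropic over `L ⊗ L⁺_v`») DISCHARGED by ★ B-p08 (g36) `anisotropic_hermForm_gramS_finSum_of_hilbertSymbol_cm`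
([Omeara1963, §63B]: `(−α⁻¹, δ²)_v = −1` ⟺ the binary norm form `t·N(x₁) + αt·N(x₂)` is anisotropic).

* `halfForm_cOfFix_mover_conj_nElem_eq_zero_iff_of_hilbertSymbol` — the `↔` form; `…_anisotropic_of_hilbertSymbol` — the `→` form = conjunct (1) of
  the operator-words hypothesis (OPW) of ★ `F0LD2ZVanOfOperatorWords.zVan_of_operatorWords` at A-p19 (g31)'s `c₀`, in the binder telescope of ★
  `F0LD2SoftRoadZBricks.ZVan` (only the binders the statement mentions: `hT₁d α hTT' hclass hT hTs`; the consumer's `hE hT₁ hT₂ hT₂d hTd χ hχ hJD₁`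
  are not needed).

USE: cell hodgecm-mathlib (D-0151), half A line LD2, soft road (π3) for the organ `LineThetaTypesComplementary₁`, brick (Z-van) — A-p19 (g31)'s KNOCK
10:50:34Z «(AN-ADAPTER)»; `--supports stmt-HodgeConjecture-24832`.  HONEST LABEL: linear algebra over `L ⊗ L⁺_v`, nothing of print asserted; HC_CM is
proved only modulo the 7 printed citations (2 remaining: hLiu418 = stmt-HodgeConjecture-24832, h413 = stmt-HodgeConjecture-24833) until rung 0 closes;
count-neutral.

## References
* [MoeglinVignerasWaldspurger1987] C. Mœglin, M.-F. Vignéras, J.-L. Waldspurger, LNM 1291 (1987), Chap. 2 II.2; Chap. 3 §IV.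
* [Rangarao1993] R. Ranga Rao, Pacific J. Math. 157 (1993), Lemma 3.2 (3.8) p. 351.
* [Omeara1963] O. T. O'Meara, *Introduction to Quadratic Forms* (1963), §63B.
* [Kudla1994] S. S. Kudla, Israel J. Math. 87 (1994), §3.
-/

set_option autoImplicit false

noncomputable section

open NumberField IsDedekindDomain MeasureTheory Matrix
open Literature.RepresentationTheory.HeisenbergGroup Literature.RepresentationTheory.HeisenbergGroup.SymplecticMatrix
open Literature.NumberTheory.Automorphic Literature.NumberTheory.Automorphic.UnitaryGroup Literature.NumberTheory.Weil1964
open Literature.NumberTheory.GelbartRogawski1991.AdaptedBlocks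
open Literature.NumberTheory.QuadraticForms
open Literature.GroupTheory Literature.LinearAlgebra.QuadraticForm

namespace Literature.NumberTheory.GelbartRogawski1991.UnitaryDualPair.LocalSplitting

variable (L : Type) [Field L] [NumberField L] [IsCMField L] (v : HeightOneSpectrum (𝓞 (maximalRealSubfield L)))
  {T₁ T₂ : Matrix (Fin 1) (Fin 1) (maximalRealSubfield L)} (hT₁d : IsUnit T₁.det) (α : (maximalRealSubfield L)ˣ)
  (hTT' : T₂ = (α : maximalRealSubfield L) • T₁)
  (hclass : hilbertSymbol (v.adicCompletion (maximalRealSubfield L))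
    ((-(α : maximalRealSubfield L)⁻¹ : maximalRealSubfield L) : v.adicCompletion (maximalRealSubfield L))
    ((imagUnitSq L : maximalRealSubfield L) : v.adicCompletion (maximalRealSubfield L)) = -1)
  {T : Matrix (Fin (1 + 1)) (Fin (1 + 1)) (maximalRealSubfield L)} (hT : T = UnitaryGroup.finSum 1 1 T₁ T₂) (hTs : T.IsSymm)

include hT₁d hTT' hclass hT in
set_option synthInstance.maxHeartbeats 400000 in -- the doubled CM telescope (as ★ `LocalDoubledSiegelUnipotentAnisotropy`)
set_option maxHeartbeats 1600000 in
/-- **`halfForm (c ·) x = 0 ↔ x = 0`** for the Rao parameter `c = cOfFix 𝕋 (E″ ι(n(τ·1)) E″⁻¹)` of the skew-scalar Siegel unipotent `n(τ·1_V)` of the doubled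
ANISOTROPIC plane `T = T₁ ⊕ αT₁` (`(−α⁻¹, δ²)_v = −1`), any mover `E″` (`E″ ℓ_Δ = ℓ_Y`), `τ` skew non-zero — ★ `halfForm_cOfFix_mover_conj_nElem_eq_zero_iff`
with `hS` := ★ `anisotropic_hermForm_gramS_finSum_of_hilbertSymbol_cm`. [cite: MoeglinVignerasWaldspurger1987, Chap. 3 §IV]
[cite: Rangarao1993, Lemma 3.2 (3.8) p. 351] [cite: Omeara1963, §63B] -/
theorem halfForm_cOfFix_mover_conj_nElem_eq_zero_iff_of_hilbertSymbol
    (E'' : LocalSp (maximalRealSubfield L) (2 + 2) (gramD (maximalRealSubfield L) 2 T) v)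
    (hE'' : (deltaLagrangian (maximalRealSubfield L) v 2).map (toLin (maximalRealSubfield L) v E'') = lagrangianY (maximalRealSubfield L) (2 + 2) v)
    (τ : LocalRing L v) (hτ : conjLocal L (IsCMField.complexConj L) v τ = -τ) (hτ0 : τ ≠ 0)
    (x : Fin (2 + 2) → v.adicCompletion (maximalRealSubfield L)) :
    halfForm (Matrix.mulVecLin (cOfFix (localGram (maximalRealSubfield L) (2 + 2) (gramD (maximalRealSubfield L) 2 T) v)
      (E'' * iotaD (maximalRealSubfield L) L (IsCMField.complexConj L) (complexConj_imagUnit L) (imagUnit_ne_zero L) (imagUnit_mul_self L) v 2 hTs rfl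
        (nElem (maximalRealSubfield L) L (IsCMField.complexConj L) v 2 rfl (τ • 1)
          (skew_smul_one (maximalRealSubfield L) L (IsCMField.complexConj L) v 2 τ hτ)) * E''⁻¹))) x = 0 ↔ x = 0 :=
  halfForm_cOfFix_mover_conj_nElem_eq_zero_iff (maximalRealSubfield L) L (IsCMField.complexConj L) (complexConj_imagUnit L) (imagUnit_ne_zero L)
    (imagUnit_mul_self L) v 2 hTs rfl
    (Literature.NumberTheory.Automorphic.Liu2021.LemD1OfPlace.anisotropic_hermForm_gramS_finSum_of_hilbertSymbol_cm L v hT₁d α hTT' hclass hT)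
    τ hτ hτ0 E'' hE'' x

include hT₁d hTT' hclass hT in
set_option synthInstance.maxHeartbeats 400000 in -- as above
set_option maxHeartbeats 1600000 in
/-- **(AN) THE RAO PARAMETER OF THE CENTRE UNIPOTENT IS ANISOTROPIC** — conjunct (1) of the operator words (OPW) of the soft road at `c₀ = cOfFix 𝕋 (E″ ι(n(τ·1)) E″⁻¹)`:
`∀ x, halfForm (c₀ ·) x = 0 → x = 0` for the doubled anisotropic plane `T₁ ⊕ αT₁`, any mover `E″`, `τ` skew non-zero.
[cite: MoeglinVignerasWaldspurger1987, Chap. 3 §IV] [cite: Omeara1963, §63B] -/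
theorem halfForm_cOfFix_mover_conj_nElem_anisotropic_of_hilbertSymbol
    (E'' : LocalSp (maximalRealSubfield L) (2 + 2) (gramD (maximalRealSubfield L) 2 T) v)
    (hE'' : (deltaLagrangian (maximalRealSubfield L) v 2).map (toLin (maximalRealSubfield L) v E'') = lagrangianY (maximalRealSubfield L) (2 + 2) v)
    (τ : LocalRing L v) (hτ : conjLocal L (IsCMField.complexConj L) v τ = -τ) (hτ0 : τ ≠ 0) :
    ∀ x : Fin (2 + 2) → v.adicCompletion (maximalRealSubfield L),
      halfForm (Matrix.mulVecLin (cOfFix (localGram (maximalRealSubfield L) (2 + 2) (gramD (maximalRealSubfield L) 2 T) v)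
        (E'' * iotaD (maximalRealSubfield L) L (IsCMField.complexConj L) (complexConj_imagUnit L) (imagUnit_ne_zero L) (imagUnit_mul_self L) v 2 hTs rfl
          (nElem (maximalRealSubfield L) L (IsCMField.complexConj L) v 2 rfl (τ • 1)
            (skew_smul_one (maximalRealSubfield L) L (IsCMField.complexConj L) v 2 τ hτ)) * E''⁻¹))) x = 0 → x = 0 :=
  fun x hx => (halfForm_cOfFix_mover_conj_nElem_eq_zero_iff_of_hilbertSymbol L v hT₁d α hTT' hclass hT hTs E'' hE'' τ hτ hτ0 x).1 hx

end Literature.NumberTheory.GelbartRogawski1991.UnitaryDualPair.LocalSplitting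

end
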